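import Mathlib
import HarnessLib
import Summits.Ventures.LatticeQCDFlow.Exactness.U1MetropolisSweepErgodic

/-!
# Independent Doeblin updates of all replicas, followed or preceded by any exact move, form a Doeblin chain: the PTBC cycle skeleton

HONEST FRAMING: exact (Metropolis-corrected) sampling algorithms for lattice gauge theory;
figures of merit are autocorrelation/cost numbers at stated couplings and volumes; no
continuum-physics claim.

Venture `LatticeQCDFlow` (cell pub-lqcd), topic `Exactness`, FANOUT row 9 (eng-latcore, the
engine `latflow.core.ptbc`: one PTBC cycle = in-replica heat-bath / over-relaxation sweeps on every
replica `r` (its own defect coupling `c(r)`), then swap proposals between neighbouring replicas and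
the translation of the periodic replica — `PTBCSwap.lean`: "Not here: the composition of a whole PTBC
cycle …, ergodicity").  NEW WORK of the cell over the tree (`RefreshScan.lean`: `siteLift`, `refresh`,
`cycle_minorised`, `cycle_refresh_eq_const`, `minorised_comp_left/right`, `uniformlyErgodic_of_minorised`;
`DoeblinUniqueness.lean`: `invariant_unique_of_minorised`; `InvariantComposition.lean`: `cycle`;
`U1MetropolisSweepErgodic.lean`: `nHit_siteLift_eval`).  Nothing here is cited as a fact.  Printed
counterpart, NAMED ONLY: Meyn–Tweedie 1993 Thm 16.0.2.

THE REPLICA PRODUCT `Π r, X r` (`R` replicas, finite; replica `r` lives on `X r`).  An in-replica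
update `K r : Kernel (X r) (X r)` acts on the product as `replicaLift K r = siteLift r (K r ∘ eval r)`
(it reads and writes replica `r` only); `replicaSweep K L = cycle (L.map (replicaLift K))` updates the
replicas of the list `L` one after the other.

* §1 **`replicaLift_minorised`** — if `K r` is Doeblin on its replica (`(K r)(x, ·) ≥ ε · ν r` from every
  `x`), its lift dominates `ε ×` the FREE REFRESH of replica `r` with law `ν r`, uniformly in the joint
  state; **`replicaSweep_minorised`** — a sweep through every replica dominates `ε^{|L|} · ⊗_r ν r` from
  EVERY joint state (the refreshes forget the start: `cycle_refresh_eq_const`); `replicaSweep_nHit`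
  (`n` sweeps of replica `r` in a row are one lift of `(K r)^n`).
* §2 **`replicaCycle_minorised_left/right`** — composing with ANY Markov move `η` on the product after
  (swaps, translations: minorant `ε^{|L|} · (⊗ν) η`) or before (minorant `ε^{|L|} · ⊗ν`) keeps a constant
  minorant; **`replicaCycle_uniformlyErgodic`**, **`replicaCycle_invariant_unique`** — so for ANY
  probability law `Π` left invariant by the cycle `η ∘ₖ replicaSweep K L` (for PTBC: the product of the
  tempered Gibbs laws, invariant by `PTBCSwap.lean` + heat-bath exactness + `invariant_cycle`):
  `|μ₀ Cᵗ(A) − Π(A)| ≤ (1 − ε^{|L|})ᵗ` from every initial law, and `Π` is the ONLY invariant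
  probability law.

For the engine: each in-replica factor is a heat-bath (+ over-relaxation) sweep whose Doeblin
minorant by a multiple of `⊗Haar` is `HeatBathSweepErgodic.heatBathSweep_minorised` /
`CabibboMarinariLatticeErgodic.latSweep_minorised` (the over-relaxation part is absorbed by
`minorised_comp_left`), uniformly in `c(r)` on a finite ladder (take the smallest constant).  NOT
CLAIMED: the invariance of the product tempered law under the full cycle is NOT re-derived here (it is
hypothesis `hP`); rates; anything about swap acceptance or round-trip times.
-/

noncomputable section

namespace Summit.Ventures.LatticeQCDFlow.Exactness

open MeasureTheory ProbabilityTheory Set Function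
open scoped ENNReal

section Replica

variable {R : Type*} [DecidableEq R] {X : R → Type*} [∀ r, MeasurableSpace (X r)]

/-- **The lift of an in-replica update** `K r` to the replica product: read replica `r`, redraw it by
`K r`, keep the others. -/
def replicaLift (K : ∀ r, Kernel (X r) (X r)) (r : R) : Kernel (∀ r, X r) (∀ r, X r) :=
  siteLift r (Kernel.comap (K r) (eval r) (measurable_pi_apply r))

/-- The lift of a Markov update is Markov. -/
instance isMarkovKernel_replicaLift (K : ∀ r, Kernel (X r) (X r)) [∀ r, IsMarkovKernel (K r)] (r : R) :
    IsMarkovKernel (replicaLift K r) := by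
  unfold replicaLift; infer_instance

/-- **The replica sweep**: update the replicas of `L` in order, each by its own kernel. -/
def replicaSweep (K : ∀ r, Kernel (X r) (X r)) (L : List R) : Kernel (∀ r, X r) (∀ r, X r) :=
  cycle (L.map (replicaLift K))

/-- The replica sweep is Markov. -/
instance isMarkovKernel_replicaSweep (K : ∀ r, Kernel (X r) (X r)) [∀ r, IsMarkovKernel (K r)] (L : List R) :
    IsMarkovKernel (replicaSweep K L) := by
  refine isMarkovKernel_cycle fun κ hκ => ?_
  obtain ⟨r, -, rfl⟩ := List.mem_map.1 hκ
  infer_instance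

/-- `n` updates of replica `r` in a row are ONE lift of the `n`-th power of its kernel. -/
theorem replicaLift_nHit (K : ∀ r, Kernel (X r) (X r)) [∀ r, IsMarkovKernel (K r)] (r : R) (n : ℕ) :
    nHit (replicaLift K r) n = siteLift r (Kernel.comap (nHit (K r) n) (eval r) (measurable_pi_apply r)) := by
  rw [replicaLift, nHit_siteLift_eval]

variable {K : ∀ r, Kernel (X r) (X r)} {ν : ∀ r, Measure (X r)} {ε : ℝ≥0∞}

/-- **A Doeblin in-replica update, lifted, dominates `ε ×` the free refresh of its replica**, uniformly
in the joint state. -/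
theorem replicaLift_minorised [∀ r, IsSFiniteKernel (K r)] [∀ r, SFinite (ν r)]
    (h : ∀ r (x : X r), ε • ν r ≤ K r x) (r : R) (ω : ∀ r, X r) :
    ε • refresh ν r ω ≤ replicaLift K r ω := by
  rw [replicaLift, siteLift_apply, Kernel.comap_apply, refresh, siteLift_apply, Kernel.const_apply,
    ← Measure.map_smul]
  exact Measure.map_mono (h r (ω r)) (measurable_update ω)

variable [Fintype R] [∀ r, IsProbabilityMeasure (ν r)]

/-- **A SWEEP THROUGH EVERY REPLICA IS DOEBLIN ON THE PRODUCT**: if every `K r` dominates `ε · ν r` from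
every state of its replica and `L` lists every replica, then `replicaSweep K L (ω, ·) ≥ ε^{|L|} · ⊗_r ν r`
from EVERY joint state `ω`. -/
theorem replicaSweep_minorised [∀ r, IsSFiniteKernel (K r)] (h : ∀ r (x : X r), ε • ν r ≤ K r x)
    {L : List R} (hL : ∀ r, r ∈ L) (ω : ∀ r, X r) :
    ε ^ L.length • Measure.pi ν ≤ replicaSweep K L ω := by
  have hF : List.Forall₂ (fun κ Φ => ∀ a : ∀ r, X r, ε • Φ a ≤ κ a) (L.map (replicaLift K)) (L.map (refresh ν)) := by
    rw [List.forall₂_map_left_iff, List.forall₂_map_right_iff, List.forall₂_same]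
    intro r _ a
    exact replicaLift_minorised h r a
  have hc := cycle_minorised hF ω
  rwa [List.length_map, cycle_refresh_eq_const hL, Kernel.const_apply] at hc

/-- **… followed by ANY Markov move `η`** (swaps, translations): `(η ∘ₖ sweep)(ω, ·) ≥ ε^{|L|} · (⊗ν) η`. -/
theorem replicaCycle_minorised_left [∀ r, IsSFiniteKernel (K r)] (h : ∀ r (x : X r), ε • ν r ≤ K r x)
    {L : List R} (hL : ∀ r, r ∈ L) (η : Kernel (∀ r, X r) (∀ r, X r)) (ω : ∀ r, X r) :
    ε ^ L.length • (Measure.pi ν).bind η ≤ (η ∘ₖ replicaSweep K L) ω :=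
  minorised_comp_left (replicaSweep_minorised h hL) η ω

/-- **… or preceded by ANY Markov move `η`**: `(sweep ∘ₖ η)(ω, ·) ≥ ε^{|L|} · ⊗ν`. -/
theorem replicaCycle_minorised_right [∀ r, IsSFiniteKernel (K r)] (h : ∀ r (x : X r), ε • ν r ≤ K r x)
    {L : List R} (hL : ∀ r, r ∈ L) (η : Kernel (∀ r, X r) (∀ r, X r)) [IsMarkovKernel η] (ω : ∀ r, X r) :
    ε ^ L.length • Measure.pi ν ≤ (replicaSweep K L ∘ₖ η) ω :=
  minorised_comp_right (replicaSweep_minorised h hL) η ω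

variable [∀ r, IsMarkovKernel (K r)]

/-- **THE PTBC CYCLE SKELETON IS UNIFORMLY ERGODIC.**  Independent Doeblin updates of every replica
(`(K r)(x, ·) ≥ ε · ν r`, `ν r` probability laws, `L` through every replica) followed by any Markov move
`η`: for EVERY probability law `P` invariant under `C = η ∘ₖ replicaSweep K L`,
`|μ₀ Cᵗ(A) − P(A)| ≤ (1 − ε^{|L|})ᵗ` for every initial law `μ₀`, every `t`, every `A`. -/
theorem replicaCycle_uniformlyErgodic (h : ∀ r (x : X r), ε • ν r ≤ K r x) {L : List R} (hL : ∀ r, r ∈ L)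
    (η : Kernel (∀ r, X r) (∀ r, X r)) [IsMarkovKernel η] {P : Measure (∀ r, X r)} [IsProbabilityMeasure P]
    (hP : Kernel.Invariant (η ∘ₖ replicaSweep K L) P) (μ₀ : Measure (∀ r, X r)) [IsProbabilityMeasure μ₀]
    (t : ℕ) (A : Set (∀ r, X r)) :
    |((fun m : Measure (∀ r, X r) => m.bind (η ∘ₖ replicaSweep K L))^[t] μ₀).real A - P.real A| ≤
      (1 - (ε ^ L.length).toReal) ^ t := by
  haveI : IsProbabilityMeasure ((Measure.pi ν).bind η) :=
    ⟨by rw [Measure.bind_apply MeasurableSet.univ (Kernel.aemeasurable _)]; simp⟩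
  exact uniformlyErgodic_of_minorised (replicaCycle_minorised_left h hL η) hP μ₀ t A

/-- **… and `P` is the ONLY invariant probability law of the cycle** (`ε > 0`). -/
theorem replicaCycle_invariant_unique (h : ∀ r (x : X r), ε • ν r ≤ K r x) (hε : 0 < ε) {L : List R}
    (hL : ∀ r, r ∈ L) (η : Kernel (∀ r, X r) (∀ r, X r)) [IsMarkovKernel η] {P P' : Measure (∀ r, X r)}
    [IsProbabilityMeasure P] [IsProbabilityMeasure P'] (hP : Kernel.Invariant (η ∘ₖ replicaSweep K L) P)
    (hP' : Kernel.Invariant (η ∘ₖ replicaSweep K L) P') : P' = P := by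
  haveI : IsProbabilityMeasure ((Measure.pi ν).bind η) :=
    ⟨by rw [Measure.bind_apply MeasurableSet.univ (Kernel.aemeasurable _)]; simp⟩
  exact invariant_unique_of_minorised (replicaCycle_minorised_left h hL η) (pos_iff_ne_zero.2 (pow_ne_zero _ hε.ne'))
    hP hP'

/-- The same two statements for a move `η` applied BEFORE the replica sweep. -/
theorem replicaCycle_uniformlyErgodic_right (h : ∀ r (x : X r), ε • ν r ≤ K r x) {L : List R}
    (hL : ∀ r, r ∈ L) (η : Kernel (∀ r, X r) (∀ r, X r)) [IsMarkovKernel η] {P : Measure (∀ r, X r)}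
    [IsProbabilityMeasure P] (hP : Kernel.Invariant (replicaSweep K L ∘ₖ η) P) (μ₀ : Measure (∀ r, X r))
    [IsProbabilityMeasure μ₀] (t : ℕ) (A : Set (∀ r, X r)) :
    |((fun m : Measure (∀ r, X r) => m.bind (replicaSweep K L ∘ₖ η))^[t] μ₀).real A - P.real A| ≤
      (1 - (ε ^ L.length).toReal) ^ t :=
  uniformlyErgodic_of_minorised (replicaCycle_minorised_right h hL η) hP μ₀ t A

end Replica

end Summit.Ventures.LatticeQCDFlow.Exactness
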